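import Summits.BirchSwinnertonDyer.BirchSwinnertonDyer.Theorems.ErratumRoadFiveEulerHalfGenusSharpKolyvaginCarrier
import HarnessLib

/-!
# (D′) ⟹ (D): S4♭'s inequality from a ring-class-rational `E′`-datum carrying POINT DIVISIBILITY
# `P_m ∈ p^{min(M,t)}·A_m` instead of the class-level clause `p^{M−t}·c_M(P_m) = 0`
# (crux stmt-BirchSwinnertonDyer-23444 `EulerHalfPOnlyMultPotMultTwinAtFive`, line `genus`, S4♯ residual (b); helper)

Seat `bsd-idea-9` (D-0154 §B ideator, lens complete; line `carrier_absorption` on item 19715, §6 rev 1.2), offered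
`--supports stmt-BirchSwinnertonDyer-23444 --as helper`.  Sequel of genus-p2's
`ErratumRoadFiveEulerHalfGenusSharpKolyvaginCarrier` (`GenusSharpKolyvagin.padicValNat_card_sha_add_le_of_ringClassRationalEprimePoints`),
whose datum `hR` carries the CLASS-LEVEL clause (D) «`p^{M−t}·c_M(P_m) = 0`» (Jetchev 2008 Thm. 1.4 read at `p ∥ N`
for the genus system).  The natural output of a POINT-LEVEL mechanism (level-lowering congruence of depth `s` +
`u`-stabilised old projection + Kummer descent on `J₀(N₀)`, line `carrier_absorption`; or any other proof of
«`p^s ∣ P^χ(m)` in `E′(K[m])`») is the clause (D′) «`P_m ∈ p^{min(M,t)}·A_m`»; this file proves (D′) ⟹ (D) for the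
generic Kolyvagin class and restates the glue with (D′).

## What

* `zsmul_kolyvaginClass_eq_zero_of_zsmul_eq` — generic (any field, any level `n`): `P = a·R`, `R ∈ A`, `n ∣ a·b`
  ⟹ `b·c_n(P) = 0` (`b·c(P) = c(bP)` by `cls_zsmul`; `bP = n·(kR) ∈ nA`, Gross 1991 Prop. 4.7 (1) "if").
* `pow_sub_zsmul_kolyvaginClass_eq_zero_of_pointDiv` — level `p^M`: `P ∈ p^{min(M,t)}A ⟹ p^{M−t}·c_M(P) = 0`.
* `exists_mem_zsmul_eq_map_of_zsmul_eq` — divisibility is transported by any additive `Φ` with `Φ(source) ⊆ A`.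
* `padicValNat_card_sha_add_le_of_ringClassRationalEprimePointsDiv` — VERBATIM the statement of
  `…_of_ringClassRationalEprimePoints` with the last clause of `hR` replaced by (D′)
  `∃ R ∈ A m, p^{min M t} • R = Pn m`; PROVED by rebuilding `hR`.

## Honest framing

THEOREMS ONLY (no `def`, no named fact, no `sorry`; axioms standard). CONDITIONAL on the displayed binders: neither
(D′) nor (E′) for the genus system is proved here; stub S4♭ ∕ S4♯ and item 23444 stay OPEN; BSD is proved for no curve.

## References

[cite: GrossLMS1991, Prop. 4.7 (1), §4 (4.4), Prop. 6.2 (1)] [cite: McCallumLMS1991, Cor. 4.5, §5 Cor. 5.6]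
[cite: Jetchev2008, Thm. 1.4, Cor. 1.5]
presearch: «b·c(P) = 0 when P ∈ aA, n ∣ ab (Kolyvagin class scaling)» → tree `cls_zsmul`, `cls_eq_zero_of_mem`
(Literature `HeegnerPointsKolyvaginPrimaryClassesProofs`), `GenusExact.PlusDescent.kolyvaginClass_zsmul`; corpus
[corpus: book:editornd-l-functions-arithmetic p0242 (Gross Prop. 4.7)]; galaxy → none needed (folklore algebra).
-/

noncomputable section

open scoped Classical

-- every file of `Summits/BirchSwinnertonDyer/BirchSwinnertonDyer/Theorems/` lives in this namespace
set_option linter.dupNamespace false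

namespace Summit.BirchSwinnertonDyer.BirchSwinnertonDyer.Theorems.GenusSharpKolyvagin



open WeierstrassCurve NumberField IsDedekindDomain Field
  Literature.NumberTheory.EllipticCurves Literature.NumberTheory.EllipticCurves.KolyvaginCocycle
  Literature.NumberTheory.EllipticCurves.RingClassField
  Literature.NumberTheory.GaloisRepresentations Literature.NumberTheory.NumberFields
  Literature.NumberTheory.DiophantineGeometry
  Summit.BirchSwinnertonDyer.Rank1Residual.X11b
  Summit.BirchSwinnertonDyer.BirchSwinnertonDyer.Theorems

universe u

/-- **`P = a·R`, `R ∈ A`, `n ∣ a·b` ⟹ `b·c_n(P) = 0`** (generic Kolyvagin class, any field, any level):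
`b·c(P) = c(b·P)` (`cls_zsmul`, Gross 1991 §4 (4.4)) and `b·P = (ab)·R = n·(kR) ∈ nA`, so the class dies
(Gross 1991 Prop. 4.7 (1) "if" ∕ McCallum 1991 Cor. 4.5, `cls_eq_zero_of_mem`).
[cite: GrossLMS1991, Prop. 4.7 (1), §4 (4.4)] [cite: McCallumLMS1991, Cor. 4.5] -/
theorem zsmul_kolyvaginClass_eq_zero_of_zsmul_eq {K : Type u} [Field K] (V : WeierstrassCurve K)
    {n a b : ℤ} (hn : n ∣ a * b) {hdiv : ∀ P : geomPoints V, ∃ Q : geomPoints V, n • Q = P}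
    {A : AddSubgroup (geomPoints V)} (hA : IsAdmissible (absoluteGaloisGroup K) A n)
    {P : geomPoints V} (hP : P ∈ invPoints (absoluteGaloisGroup K) A n)
    {R : geomPoints V} (hR : R ∈ A) (hRP : a • R = P) :
    b • kolyvaginClass V n hdiv hA P hP = 0 := by
  obtain ⟨k, hk⟩ := hn
  obtain ⟨Q, hQ⟩ := hdiv P
  have hbP : b • P ∈ invPoints (absoluteGaloisGroup K) A n := AddSubgroup.zsmul_mem _ hP b
  have hbQ : n • (b • Q) = b • P := by rw [smul_comm, hQ]
  rw [kolyvaginClass_eq_cls hA hP hQ, ← cls_zsmul hA _ hP hQ b hbP hbQ]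
  refine cls_eq_zero_of_mem hA _ hbP hbQ ⟨k • R, A.zsmul_mem hR k, ?_⟩
  rw [← mul_smul, ← hk, mul_comm, mul_smul, hRP]

/-- **(D′) ⟹ (D) at level `p^M`**: `P ∈ p^{min(M,t)}·A ⟹ p^{M−t}·c_M(P) = 0` (truncated subtraction:
`min(M,t) + (M ∸ t) = M`; for `t > M` the hypothesis says `P ∈ p^M A` and the class itself vanishes).
[cite: GrossLMS1991, Prop. 4.7 (1)] [cite: Jetchev2008, Thm 1.4, Cor. 1.5] -/
theorem pow_sub_zsmul_kolyvaginClass_eq_zero_of_pointDiv {K : Type u} [Field K] (V : WeierstrassCurve K)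
    {p M t : ℕ} {hdiv : ∀ P : geomPoints V, ∃ Q : geomPoints V, ((p ^ M : ℕ) : ℤ) • Q = P}
    {A : AddSubgroup (geomPoints V)} (hA : IsAdmissible (absoluteGaloisGroup K) A ((p ^ M : ℕ) : ℤ))
    {P : geomPoints V} (hP : P ∈ invPoints (absoluteGaloisGroup K) A ((p ^ M : ℕ) : ℤ))
    (hD : ∃ R ∈ A, ((p ^ min M t : ℕ) : ℤ) • R = P) :
    ((p : ℤ) ^ (M - t)) • kolyvaginClass V _ hdiv hA P hP = 0 := by
  obtain ⟨R, hR, hRP⟩ := hD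
  have h : min M t + (M - t) = M := by omega
  refine zsmul_kolyvaginClass_eq_zero_of_zsmul_eq V ⟨1, ?_⟩ hA hP hR hRP
  simp only [Nat.cast_pow, ← pow_add, h, mul_one]

/-- **The additive seam**: an additive map `Φ` with `Φ(source) ⊆ A` transports `k`-divisibility of `x` to
`Φ x ∈ k·A` (used with `Φ` = twist isomorphism `E′(K[m]) ⥲ W(K[m])` composed with `W(K[m]) ↪ W(K̄)` along
`emb m`, `A = A_m`, `x = P^χ(m)`, `k = p^{min(M,t)}`). [folklore] -/
theorem exists_mem_zsmul_eq_map_of_zsmul_eq {X Y : Type*} [AddCommGroup X] [AddCommGroup Y]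
    (Φ : X →+ Y) (A : AddSubgroup Y) (hΦA : ∀ x, Φ x ∈ A) {k : ℤ} {x Q : X} (hQ : k • Q = x) :
    ∃ R ∈ A, k • R = Φ x :=
  ⟨Φ Q, hΦA Q, by rw [← map_zsmul, hQ]⟩

variable (W : WeierstrassCurve ℚ) {K : Type} [Field K] [NumberField K]

/-- **S4♭'s inequality from the (D′)-datum** — the (D)-TRANSPORT, PROVED: GIVEN the off-`p` Selmer clause
`hL` (VERBATIM genus-p2's, = the body of line `genus`'s `GenusKolyvaginLocalOffP W p K ιc`, PROVED on the
served frame in that skeleton) and a datum `hR` = VERBATIM the `hR` of `…_of_ringClassRationalEprimePoints` with (D) replaced by (D′)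
«`∃ R ∈ A m, p^{min M t} • R = P_m`», THEN
`ord_p #Ш(W/K) + 2t ≤ 2·ord_p [W(K) : ℤP]`.  Proof: rebuild genus-p2's `hR` from the (D′)-datum, clause (D)
by `pow_sub_zsmul_kolyvaginClass_eq_zero_of_pointDiv`, and apply
`padicValNat_card_sha_add_le_of_ringClassRationalEprimePoints`.  Conditional on the displayed binders;
(D′) is NOT proved here.  [cite: GrossLMS1991, Prop. 4.7 (1), Prop. 6.2 (1)]
[cite: McCallumLMS1991, §5 Cor. 5.6] [cite: Jetchev2008, Thm. 1.4, Cor. 1.5] -/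
theorem padicValNat_card_sha_add_le_of_ringClassRationalEprimePointsDiv [W.IsElliptic]
    (hK : IsImaginaryQuadratic K) (ιc : K →+* ℂ) {p : ℕ} [Fact p.Prime] (hp2 : p ≠ 2)
    (hρ : W.HasSurjectiveModNGaloisRep p)
    {Pt : (W.baseChange K).toAffine.Point} (hnt : ¬ IsOfFinAddOrder Pt)
    (hidx : (AddSubgroup.zmultiples Pt).index ≠ 0) (t : ℕ) {n' : ℤ} (hn' : IsCoprime (p : ℤ) n')
    (hL : ∀ {m : ℕ} (_hm : m ≠ 0) (e : ringClassField K ιc m →ₐ[K] AlgebraicClosure K)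
      (_hKol : ∀ q ∈ m.primeFactors, IsKolyvaginPrime (W.conductorNorm ℤ) W K p q)
      {M : ℕ} {hdiv : ∀ P : geomPoints (W.baseChange K), ∃ Q, ((p ^ M : ℕ) : ℤ) • Q = P}
      {A : AddSubgroup (geomPoints (W.baseChange K))}
      (hA : KolyvaginCocycle.IsAdmissible (Field.absoluteGaloisGroup K) A ((p ^ M : ℕ) : ℤ))
      (_hArat : ∀ a ∈ A, ∀ Φ : Field.absoluteGaloisGroup K,
        (∀ x : ringClassField K ιc m, Φ • e x = e x) → Φ • a = a)
      {P : geomPoints (W.baseChange K)}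
      (hP : P ∈ KolyvaginCocycle.invPoints (Field.absoluteGaloisGroup K) A ((p ^ M : ℕ) : ℤ))
      (v : HeightOneSpectrum (𝓞 K)) (_hv : ((m : ℕ) : 𝓞 K) ∉ v.asIdeal) (_hvp : ((p : ℕ) : 𝓞 K) ∉ v.asIdeal),
      kolyvaginClass (W.baseChange K) ((p ^ M : ℕ) : ℤ) hdiv hA P hP ∈
        selmerLocalKer (W.baseChange K) (v.adicCompletion K) ((p ^ M : ℕ) : ℤ))
    (hR : ∀ {M : ℕ} (_hM : 1 ≤ M)
        (hdiv : ∀ Q : geomPoints (W.baseChange K), ∃ R, ((p ^ M : ℕ) : ℤ) • R = Q)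
        (c : K ≃ₐ[ℚ] K) (_hc : c ≠ 1),
        ∃ (ε : ℤ) (τ : AlgebraicClosure K ≃+* AlgebraicClosure K) (hτ : IsLiftOfAut c τ)
          (A : ℕ → AddSubgroup (geomPoints (W.baseChange K)))
          (hA : ∀ m, KolyvaginCocycle.IsAdmissible (Field.absoluteGaloisGroup K) (A m)
            ((p ^ M : ℕ) : ℤ))
          (emb : ∀ m : ℕ, ringClassField K ιc m →ₐ[K] AlgebraicClosure K)
          (Pn : ℕ → geomPoints (W.baseChange K))
          (hPn : ∀ m, Pn m ∈
            KolyvaginCocycle.invPoints (Field.absoluteGaloisGroup K) (A m) ((p ^ M : ℕ) : ℤ)),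
          (ε = 1 ∨ ε = -1) ∧
          IsOfFinAddOrder (Affine.Point.map (W' := W) (c : K →ₐ[ℚ] K) Pt - ε • Pt) ∧
          (∀ m, ∀ a ∈ A m, hτ.pointsMap W a ∈ A m) ∧
          Pn 1 = toGeomPoints (W.baseChange K) Pt ∧
          (∀ m, m ≠ 0 → ∀ a ∈ A m, ∀ Φ : Field.absoluteGaloisGroup K,
            (∀ x : ringClassField K ιc m, Φ • emb m x = emb m x) → Φ • a = a) ∧
          (∀ m, ∀ a ∈ A m, ∀ v : HeightOneSpectrum (𝓞 K), ((p : ℕ) : 𝓞 K) ∈ v.asIdeal →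
            n' • pointsMap (W.baseChange K) (v.adicCompletion K) a ∈ E0Receptacle (W.baseChange K) v) ∧
          (∀ m : ℕ, Squarefree m →
            (∀ q ∈ m.primeFactors,
              IsKolyvaginPrime (W.conductorNorm ℤ) W K p q ∧ FrobEqFrobInfty W K (p ^ M) q) →
            (∃ B ∈ A m, hτ.pointsMap W (Pn m) =
              (ε * (-1) ^ m.primeFactors.card) • Pn m + ((p ^ M : ℕ) : ℤ) • B) ∧
            (∀ ℓ : ℕ, ℓ.Prime → ℓ ∣ m → ∀ v : HeightOneSpectrum (𝓞 K), (ℓ : 𝓞 K) ∈ v.asIdeal →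
              ∀ a : ℕ, (((p : ℤ) ^ a) •
                  kolyvaginClass (W.baseChange K) _ hdiv (hA m) (Pn m) (hPn m) ∈
                  selmerLocalKer (W.baseChange K) (v.adicCompletion K) ((p ^ M : ℕ) : ℤ) ↔
                ((p : ℤ) ^ a) • kolyvaginClass (W.baseChange K) _ hdiv (hA (m / ℓ)) (Pn (m / ℓ))
                    (hPn (m / ℓ)) ∈
                  (W.baseChange K).torsionLocalKer (v.adicCompletion K) ((p ^ M : ℕ) : ℤ))) ∧
            (∃ R ∈ A m, ((p ^ min M t : ℕ) : ℤ) • R = Pn m)))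
    [Finite (W.baseChange K).sha] :
    padicValNat p (Nat.card (W.baseChange K).sha) + 2 * t ≤
      2 * padicValNat p (AddSubgroup.zmultiples Pt).index := by
  refine padicValNat_card_sha_add_le_of_ringClassRationalEprimePoints W hK ιc hp2 hρ hnt hidx t hn' hL ?_
  intro M hM hdiv c hc
  obtain ⟨ε, τ, hτ, A, hA, emb, Pn, hPn, hε, h53, hAτ, hPn1, hrat, hE0, hm⟩ := hR hM hdiv c hc
  exact ⟨ε, τ, hτ, A, hA, emb, Pn, hPn, hε, h53, hAτ, hPn1, hrat, hE0, fun m hsq hq ↦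
    ⟨(hm m hsq hq).1, (hm m hsq hq).2.1,
      pow_sub_zsmul_kolyvaginClass_eq_zero_of_pointDiv (W.baseChange K) (hA m) (hPn m) (hm m hsq hq).2.2⟩⟩

end Summit.BirchSwinnertonDyer.BirchSwinnertonDyer.Theorems.GenusSharpKolyvagin

end
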